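import Literature.Claims.NS.GlimmPetrillo2026
import Literature.Analysis.FluidPDE.TorusWeakStrongUniqueness
import Literature.Analysis.FluidPDE.NSHopfExistenceProofs
import Literature.Analysis.FluidPDE.NSLerayHopf
import Literature.Analysis.FluidPDE.TaoClassGlobal
import Literature.Analysis.FunctionSpaces.FlatTorusProofs
import Literature.Analysis.FunctionSpaces.TorusLinearisedNSEnergy
import Literature.Claims.NS.ClayPeriodicPressureBridge
import Literature.Analysis.FluidPDE.NSCoriolisTorus
import HarnessLib

/-!
# C07 `GlimmPetrillo2026` — salvage: the TRUE steps of the typed skeleton, discharged in the kernel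

Cell `ns-claims` (D-0090 NS-CLAIMS SWEEP), salvage seat `ns-claims-salvage-p5`. The claim skeleton
`Literature/Claims/NS/GlimmPetrillo2026.lean` (typist-5, p466336) types J. Glimm – J. Petrillo,
arXiv:2410.09261 v10, as six `Prop`-valued steps (+ two reading-R2 variants); nothing there is
asserted. This file PROVES the steps that are true as typed, so that the refuter's per-step status
table (TYPING-HYGIENE 11) can mark them «kernel-discharged»:

* `step_2_natural : Step_2 Notions.natural` — **Theorem 3.1 (a), l.975–981, in the selection-free
  reading**: every smooth divergence-free zero-mean datum on `𝕋³` launches a global Leray–Hopf weak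
  solution — Hopf's existence theorem (tree `hopf_existence_torus_holds`, Hopf 1951 / RRS 2016 Thm 4.4).
* `step_6_holds : Step_6` — **the §1.4 prize sentence (errata reading of Clay (D))**: a Clay-sense
  periodic solution from `lift u₀` descends to a global classical solution on `𝕋³`
  (`IsClassicalNSSolutionOn.to_torus_holds`), with which every global Leray–Hopf weak solution from
  `u₀` coincides a.e. (weak–strong uniqueness on `𝕋³`, RRS 2016 Thm 6.10 — tree
  `Torus.IsGlobalLerayHopf.ae_eq_of_isClassicalNSSolutionOn_Ici`, p461824); so a non-globally-regular
  Leray–Hopf solution forbids Clay-sense solvability.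
* `nuT_eq_dissRate`, `step_5alt_holds : Step_5alt` — **Lemma 3.1 / eq. (nu-NL) at a regular time and
  Theorem 3.1 (c) under reading R2**: for a classical solution `ν_t(s) = ν_{t,NL} + ν_{t,Temp} =
  0 + ν‖∇v(s)‖²` (the energy identity paired with `v`), hence `0 ≤ ν_t` and `ν‖∇v‖² ≤ ν_t`.

* (rev 2) `step_6_printed`, `clayPrinted_of_finiteHorizon`, `clayPrinted_of_claimed`,
  `clayPrinted_of_steps_natural` — the Clay link upgraded to Fefferman's PRINTED (D)
  (`NavierStokesBreakdownPeriodic`): pressure periodicity is free for `f ≡ 0` (lit-4's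
  `ClayPeriodicPressureBridge`), so in the natural reading `Step_3 → Step_4 → Step_5 → (D)`.

* (rev 3) `solNorm_le_mul_exp` — the TRUE upper-bound decay law `‖v(t)‖₂ ≤ ‖v(s)‖₂e^{−4π²ν(t−s)}`
  for mean-zero classical solutions on `𝕋³` (§1.5 l.248 first sentence, honest constant).

Not touched here (refuter-3's locators): `Step_3`/`Step_3alt` (the floor `c·e^{−νs/2} ≤ ‖v(s)‖`,
false on Stokes eigenmodes), `Step_5` (R1 domination), `Step_4`, the headline. The amplitude test that
kills the headline in the natural reading is `Literature.Barriers.NavierStokesRegularity.SmallDataGlobalRegularity`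
(`Torus.exists_global_classicalNS_smul`, p458172) composed with p461824.

WHAT THIS IS NOT: not a claim about NS regularity or blow-up; not a claim about any author beyond
the typed locator.
-/

noncomputable section

open MeasureTheory Set Filter Function
open scoped ENNReal Topology RealInnerProductSpace ContDiff

-- The mandated landing namespace repeats the summit name by design (D-0017).
set_option linter.dupNamespace false

namespace Summit.NavierStokesRegularity.NavierStokesRegularity.Theorems

namespace GlimmPetrillo2026

open Literature.Claims.NS.GlimmPetrillo2026 Literature.Analysis Literature.Analysis.FluidPDE
  Literature.Analysis.FunctionSpaces

/-- **Step 2 of the skeleton holds in the natural (selection-free) reading: Hopf's existence theorem on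
`𝕋³`** (Hopf 1951; Robinson–Rodrigo–Sadowski 2016 Thm 4.4; tree `hopf_existence_torus_holds`,
PROVED): every smooth divergence-free zero-mean datum launches a global Leray–Hopf weak solution of the
unforced equations. [cite: GlimmPetrillo2026, Thm 3.1(a) l.975–981 with §1.2 l.136–138] -/
theorem step_2_natural : Literature.Claims.NS.GlimmPetrillo2026.Step_2 Notions.natural := by
  intro ν hν u₀ hu₀
  obtain ⟨hsm, hdiv, -⟩ := hu₀
  have hf : AEStronglyMeasurable
      (Torus.stLift (0 : ℝ → UnitAddTorus (Fin 3) → EuclideanSpace ℝ (Fin 3)))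
      (volume.restrict (Ioi 0 ×ˢ univ)) :=
    aestronglyMeasurable_const (b := (0 : EuclideanSpace ℝ (Fin 3)))
  have hf₂ : ∀ T : ℝ, 0 < T → ∫⁻ t in Ioo 0 T, ∫⁻ x : UnitAddTorus (Fin 3),
      ‖(0 : ℝ → UnitAddTorus (Fin 3) → EuclideanSpace ℝ (Fin 3)) t x‖ₑ ^ 2 < ⊤ := by
    intro T hT; simp
  obtain ⟨u, hu⟩ := hopf_existence_torus_holds ν hν u₀ (hsm.memLp 2)
    (Torus.IsDivFree.isWeaklyDivFree_holds hsm hdiv) 0 hf hf₂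
  exact ⟨u, hu, trivial⟩

/-- **Step 6 of the skeleton (the §1.4 prize sentence, errata reading) is TRUE — it is the contrapositive
of weak–strong uniqueness on `𝕋³`** (Robinson–Rodrigo–Sadowski 2016 Thm 6.10; tree
`Torus.IsGlobalLerayHopf.ae_eq_of_isClassicalNSSolutionOn_Ici`, p461824, PROVED): if the periodic
Cauchy problem for `lift u₀`, `f ≡ 0`, has a Clay-sense solution with `u` and `p` periodic, descend it to
a global classical solution `(v, q)` on `𝕋³` with `v 0 = u₀` (`IsClassicalNSSolutionOn.to_torus_holds`);
every global Leray–Hopf weak solution from `u₀` then coincides with `v` a.e. on every slice, i.e. is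
globally regular. [cite: GlimmPetrillo2026, §1.4 l.187–227] [cite: RobinsonRodrigoSadowski2016, Thm. 6.10] -/
theorem step_6_holds : Literature.Claims.NS.GlimmPetrillo2026.Step_6 := by
  intro ν hν u₀ hsm hdiv u hLH hnot hsolv
  apply hnot
  obtain ⟨U, P, hUs, hPs, hns, hadm⟩ := hsolv
  have hcl : FluidPDE.IsClassicalNSSolutionOn (Ici 0) ν 0 U P :=
    (isNavierStokesSolution_and_smooth_iff.1 ⟨hns, hUs, hPs⟩).1
  -- descend the periodic slices to the torus
  set v : ℝ → UnitAddTorus (Fin 3) → EuclideanSpace ℝ (Fin 3) := fun t x => U t (Torus.repr x) with hv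
  set q : ℝ → UnitAddTorus (Fin 3) → ℝ := fun t x => P t (Torus.repr x) with hq
  have hvU : ∀ t ∈ Ici (0 : ℝ), (fun s => Torus.lift (v s)) t = U t := fun t ht =>
    Torus.lift_descend_holds (U t) (hadm t ht).1
  have hqP : ∀ t ∈ Ici (0 : ℝ), (fun s => Torus.lift (q s)) t = P t := fun t ht =>
    Torus.lift_descend_holds (P t) (hadm t ht).2
  have hcl' : FluidPDE.IsClassicalNSSolutionOn (Ici 0) ν
      (fun t => Torus.lift ((0 : ℝ → UnitAddTorus (Fin 3) → EuclideanSpace ℝ (Fin 3)) t))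
      (fun t => Torus.lift (v t)) (fun t => Torus.lift (q t)) := by
    have h0 : (fun t => Torus.lift ((0 : ℝ → UnitAddTorus (Fin 3) → EuclideanSpace ℝ (Fin 3)) t)) =
        (0 : ℝ → EuclideanSpace ℝ (Fin 3) → EuclideanSpace ℝ (Fin 3)) := rfl
    rw [h0]
    exact hcl.congr_slices hvU hqP
  have htor : Torus.IsClassicalNSSolutionOn (Ici 0) ν 0 v q :=
    IsClassicalNSSolutionOn.to_torus_holds hcl'
  have hv0 : v 0 = u₀ := by
    funext x
    show U 0 (Torus.repr x) = u₀ x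
    rw [hns.initial, Torus.lift_apply, Torus.proj_repr]
  refine ⟨v, q, htor, hv0, ?_⟩
  have hLH' : Torus.IsGlobalLerayHopf ν 0 (v 0) u := by rw [hv0]; exact hLH
  exact hLH'.ae_eq_of_isClassicalNSSolutionOn_Ici htor hν.le

/-- **The turbulent dissipation of a classical solution IS the viscous dissipation rate**: for a
classical solution `(v, p)` of the unforced equations on `𝕋³ × S` and `s ∈ S`,
`ν_t(s) = ν_{t,NL}(s) + ν_{t,Temp}(s) = 0 + ν‖∇v(s)‖²` — the paired energy identity of Lemma 3.1 at a
regular time: `∫⟪(v·∇)v, v⟫ = 0`, and `∫⟪v, −∂ₜv⟫ = −∫⟪v, νΔv − ∇p − (v·∇)v⟫ = ν‖∇v‖²` (momentum equation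
pointwise, then `∫⟪Δv, v⟫ = −‖∇v‖²`, `∫⟪∇p, v⟫ = 0`, `∫⟪(v·∇)v, v⟫ = 0` for divergence-free `v`; tree
`Torus.integral_inner_convect_self_eq_zero`, `Torus.integral_inner_gradient_eq_zero_of_isDivFree`,
`Torus.integral_inner_laplacian_self_eq_neg_gradNormSq_of_isSmooth`). [cite: GlimmPetrillo2026, Lemma 3.1 l.935–959 and eq. (nu-NL) l.686–694] -/
theorem nuT_eq_dissRate {S : Set ℝ} {ν : ℝ}
    {v : ℝ → UnitAddTorus (Fin 3) → EuclideanSpace ℝ (Fin 3)} {p : ℝ → UnitAddTorus (Fin 3) → ℝ}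
    (hv : Torus.IsClassicalNSSolutionOn S ν 0 v p) {s : ℝ} (hs : s ∈ S) :
    nuT S v s = dissRate ν v s := by
  have hvs : Torus.IsSmooth (v s) := hv.smooth_velocity.isSmooth_slice hs
  have hps : Torus.IsSmooth (p s) := hv.smooth_pressure.isSmooth_slice hs
  have hdiv : Torus.IsDivFree (v s) := hv.divFree s hs
  -- the momentum equation solved for `∂ₜv`
  have hmom : ∀ x, Torus.timeDerivWithin S v s x =
      ν • Torus.laplacian (v s) x - Torus.gradient (p s) x - Torus.convect (v s) (v s) x := by
    intro x
    have h := hv.momentum s hs x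
    rw [Pi.zero_apply, Pi.zero_apply, add_zero] at h
    rw [← h]; abel
  have hNL : nuNL v s = 0 := Torus.integral_inner_convect_self_eq_zero hvs hdiv
  have hTemp : nuTemp S v s = ν * Torus.gradNormSq (v s) := by
    unfold nuTemp
    have hpt : ∀ x, ⟪v s x, -Torus.timeDerivWithin S v s x⟫ =
        -ν * ⟪Torus.laplacian (v s) x, v s x⟫ + ⟪Torus.gradient (p s) x, v s x⟫ +
          ⟪Torus.convect (v s) (v s) x, v s x⟫ := by
      intro x
      rw [hmom x, inner_neg_right, inner_sub_right, inner_sub_right, inner_smul_right,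
        real_inner_comm (v s x) (Torus.laplacian (v s) x), real_inner_comm (v s x) (Torus.gradient (p s) x),
        real_inner_comm (v s x) (Torus.convect (v s) (v s) x)]
      ring
    simp_rw [hpt]
    have hi1 : Integrable (fun x => -ν * ⟪Torus.laplacian (v s) x, v s x⟫) volume :=
      ((hvs.laplacian.inner hvs).integrable).const_mul _
    have hi2 : Integrable (fun x => ⟪Torus.gradient (p s) x, v s x⟫) volume :=
      (hps.gradient.inner hvs).integrable
    have hi3 : Integrable (fun x => ⟪Torus.convect (v s) (v s) x, v s x⟫) volume :=
      ((hvs.convect hvs).inner hvs).integrable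
    have hA : ∫ x, (-ν * ⟪Torus.laplacian (v s) x, v s x⟫ + ⟪Torus.gradient (p s) x, v s x⟫ +
        ⟪Torus.convect (v s) (v s) x, v s x⟫) =
        (∫ x, -ν * ⟪Torus.laplacian (v s) x, v s x⟫) + (∫ x, ⟪Torus.gradient (p s) x, v s x⟫) +
          ∫ x, ⟪Torus.convect (v s) (v s) x, v s x⟫ := by
      have hi12 : Integrable (fun x => -ν * ⟪Torus.laplacian (v s) x, v s x⟫ +
          ⟪Torus.gradient (p s) x, v s x⟫) volume := hi1.add hi2
      rw [integral_add hi12 hi3, integral_add hi1 hi2]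
    rw [hA, integral_const_mul, Torus.integral_inner_laplacian_self_eq_neg_gradNormSq_of_isSmooth hvs,
      Torus.integral_inner_gradient_eq_zero_of_isDivFree hvs hps hdiv,
      Torus.integral_inner_convect_self_eq_zero hvs hdiv]
    ring
  unfold nuT dissRate
  rw [hNL, hTemp, zero_add]

/-- **Step 5′ of the skeleton (reading R2: Theorem 3.1 (c) with «decay of u» = viscous dissipation
rate) is TRUE — kernel-discharged**: on every interval of regularity, `0 ≤ ν_t(s)` and
`ν‖∇v(s)‖² ≤ ν_t(s)` (indeed `=`, `nuT_eq_dissRate`). [cite: GlimmPetrillo2026, Thm 3.1(c) l.986–991 and Thm 5.1 proof l.1230] -/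
theorem step_5alt_holds : Literature.Claims.NS.GlimmPetrillo2026.Step_5alt := by
  intro ν hν u₀ _ T v p hv _ s hs
  rw [nuT_eq_dissRate hv hs]
  refine ⟨?_, le_rfl⟩
  unfold dissRate Torus.gradNormSq
  exact mul_nonneg hν.le (integral_nonneg fun x => Finset.sum_nonneg fun i _ => sq_nonneg _)

/-! ## The prize link for Clay's PRINTED (D) (rev 2): pressure periodicity is free for `f ≡ 0` -/

/-- **Step 6 in the printed-(D) form** (Fefferman's (10): only `u` periodic): for `ν > 0` and a smooth
divergence-free datum on `ℝ³/ℤ³`, a non-globally-regular global Leray–Hopf weak solution forbids ANY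
smooth solution of the periodic Cauchy problem for `lift u₀`, `f ≡ 0`, with `u(·,t)` periodic — the
pressure can always be renormalised to a periodic one by a Galilean boost (lit-4's
`ClayVariants.clayPeriodic_solvable_zero_iff_errata`, Tao 2013 Lemma 4.1 (ii)), after which
`step_6_holds` applies. [cite: GlimmPetrillo2026, §1.4 l.187–227] [cite: Tao2013Localisation, Lemma 4.1 (ii)] -/
theorem step_6_printed {ν : ℝ} (hν : 0 < ν) {u₀ : UnitAddTorus (Fin 3) → EuclideanSpace ℝ (Fin 3)}
    (hsm : Torus.IsSmooth u₀) (hdiv : Torus.IsDivFree u₀)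
    {u : ℝ → UnitAddTorus (Fin 3) → EuclideanSpace ℝ (Fin 3)} (hLH : Torus.IsGlobalLerayHopf ν 0 u₀ u)
    (hng : ¬ IsGloballyRegular ν u₀ u) :
    ¬ Literature.Claims.NS.ClayVariants.clayPeriodic.Solvable ν 0 (Torus.lift u₀) := fun h =>
  step_6_holds ν hν u₀ hsm hdiv u hLH hng
    ((Literature.Claims.NS.ClayVariants.clayPeriodic_solvable_zero_iff_errata ν _).1 h)

/-- **The Clay link of the skeleton, upgraded to Clay's PRINTED statement (D)** (the summit leaf
`NavierStokesBreakdownPeriodic`, at every viscosity): the paper's data step, its existence step, the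
finite-horizon conclusion (`FiniteHorizon`, which Steps 3–5 would give) and NOTHING ELSE — Step 6 is now a
theorem (`step_6_holds`), the pressure axis is closed by the Galilean renormalisation and the viscosity is
moved by the Δ7 scaling (lit-4's `ClayVariants.navierStokesBreakdownPeriodic_of_not_errataSolvable_zero`).
[cite: GlimmPetrillo2026, §1.4 l.209–220 and Thm 5.1 l.1204–1207] -/
theorem clayPrinted_of_finiteHorizon (N : Notions) (h1 : Step_1 N) (h2 : Step_2 N) (h : FiniteHorizon) :
    Summit.NavierStokesRegularity.NavierStokesRegularity.NavierStokesBreakdownPeriodic := by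
  obtain ⟨u₀, hfm, hne, hturb⟩ := h1
  have hadm : IsAdmissibleDatum u₀ := hfm.isAdmissibleDatum
  obtain ⟨u, hLH, hsel⟩ := h2 1 one_pos u₀ hadm
  have hng : ¬ IsGloballyRegular 1 u₀ u :=
    (claimed_of_finiteHorizon N h 1 one_pos u₀ hfm hne hturb u hLH hsel).2
  have hns : ¬ Literature.Claims.NS.ClayVariants.clayPeriodicErrata.Solvable 1 0 (Torus.lift u₀) :=
    step_6_holds 1 one_pos u₀ hadm.1 hadm.2.1 u hLH hng
  have hsm : ContDiff ℝ ∞ (Torus.lift u₀) := hadm.1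
  have hdiv : NSWave0.IsDivFree (Torus.lift u₀) :=
    (isDivFree_lift_iff (hadm.1.isContDiff (by simp))).2 hadm.2.1
  exact Literature.Claims.NS.ClayVariants.navierStokesBreakdownPeriodic_of_not_errataSolvable_zero one_pos
    hsm hdiv (Torus.isLatticePeriodic_lift u₀) hns

/-- **`Step_1 N → Step_2 N → Step_3 → Step_4 → Step_5 → Clay (D) as printed`** (five steps; Step 6
discharged). [cite: GlimmPetrillo2026, §1.4 l.209–220 and Thm 5.1 l.1204–1207] -/
theorem clayPrinted_of_claimed (N : Notions) (h1 : Step_1 N) (h2 : Step_2 N) (h3 : Step_3) (h4 : Step_4)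
    (h5 : Step_5) : Summit.NavierStokesRegularity.NavierStokesRegularity.NavierStokesBreakdownPeriodic :=
  clayPrinted_of_finiteHorizon N h1 h2 (finiteHorizon_of_steps h3 h4 h5)

/-- In the natural reading only the three load-bearing steps remain: **`Step_3 → Step_4 → Step_5 →
Clay (D) as printed`** (`Step_1`/`Step_2` discharged by `exists_finiteModeDatum_ne_zero` /
`step_2_natural`). [cite: GlimmPetrillo2026, Thm 5.1 l.1204–1207] -/
theorem clayPrinted_of_steps_natural (h3 : Step_3) (h4 : Step_4) (h5 : Step_5) :
    Summit.NavierStokesRegularity.NavierStokesRegularity.NavierStokesBreakdownPeriodic :=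
  clayPrinted_of_claimed Notions.natural
    (let ⟨u₀, hfm, hne⟩ := exists_finiteModeDatum_ne_zero; ⟨u₀, hfm, hne, hne⟩)
    step_2_natural h3 h4 h5

/-! ## The TRUE decay law (rev 3): mean-zero classical solutions on `𝕋³` decay at least like `e^{−4π²νt}` -/

/-- **«The Navier–Stokes solutions decay with the rate O(e^{−νλt}) or faster» — the true UPPER-bound
half of the paper's rate rule (§1.5 l.248, first sentence), with the honest constant**: for a classical
solution `(v, p)` of the unforced equations on `𝕋³ = ℝ³/ℤ³` over a convex time set `S`, mean-zero at a
time `s ∈ S`, the decay curve satisfies `‖v(t)‖_{L²} ≤ ‖v(s)‖_{L²} · e^{−4π²ν(t−s)}` for `t ≥ s` in `S`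
(Poincaré `λ₁ = 4π²` and the energy identity; tree `torus_kineticEnergy_le_mul_exp`, the `Ω = 0` case
of the rotating-frame file, BMN 1999 Rem. 5.2). In particular no floor `c·e^{−νt/2} ≤ ‖v(t)‖` with
`c > 0` can hold on a long interval of regularity (`4π² > ½`), which is how the typed Step 3 meets the
global eigenmode solutions. [cite: GlimmPetrillo2026, §1.5 l.248–252] [cite: BabinMahalovNicolaenko1999, Remark 5.2] -/
theorem solNorm_le_mul_exp {S : Set ℝ} {ν : ℝ} (hν : 0 ≤ ν) (hS : Convex ℝ S)
    {v : ℝ → UnitAddTorus (Fin 3) → EuclideanSpace ℝ (Fin 3)} {p : ℝ → UnitAddTorus (Fin 3) → ℝ}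
    (hv : Torus.IsClassicalNSSolutionOn S ν 0 v p) {s t : ℝ} (hs : s ∈ S) (ht : t ∈ S) (hst : s ≤ t)
    (h0 : Torus.HasZeroMean (v s)) :
    solNorm v t ≤ solNorm v s * Real.exp (-(4 * Real.pi ^ 2 * ν * (t - s))) := by
  -- read the solution as a solution of the rotating system with `Ω = 0`
  have hv' : Torus.IsClassicalNSSolutionOn S ν
      (fun τ x => (0 : ℝ → UnitAddTorus (Fin 3) → EuclideanSpace ℝ (Fin 3)) τ x -
        coriolisForce 0 (v τ x)) v p := by
    have h : (fun τ x => (0 : ℝ → UnitAddTorus (Fin 3) → EuclideanSpace ℝ (Fin 3)) τ x -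
        coriolisForce 0 (v τ x)) = 0 := by
      funext τ x; simp
    rw [h]; exact hv
  have hcor : IsClassicalNSCoriolisSolutionOn S ν 0 0 (fun τ => Torus.lift (v τ))
      (fun τ => Torus.lift (p τ)) := IsClassicalNSCoriolisSolutionOn.of_torus hv'
  have hE := IsClassicalNSCoriolisSolutionOn.torus_kineticEnergy_le_mul_exp hcor hν hS hs ht hst h0
  -- `‖v(τ)‖₂ = √(2 E(τ))`
  have hsol : ∀ τ, solNorm v τ = Real.sqrt (2 * Torus.kineticEnergy (v τ)) := by
    intro τ
    unfold solNorm Torus.kineticEnergy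
    congr 1
    ring
  have hEs : 0 ≤ Torus.kineticEnergy (v s) := by
    unfold Torus.kineticEnergy
    exact mul_nonneg (by norm_num) (integral_nonneg fun x => by positivity)
  rw [hsol t, hsol s]
  calc Real.sqrt (2 * Torus.kineticEnergy (v t))
      ≤ Real.sqrt (2 * (Torus.kineticEnergy (v s) * Real.exp (-(8 * Real.pi ^ 2 * ν * (t - s))))) :=
        Real.sqrt_le_sqrt (by linarith)
    _ = Real.sqrt (2 * Torus.kineticEnergy (v s)) * Real.exp (-(4 * Real.pi ^ 2 * ν * (t - s))) := by
        have hexp : Real.exp (-(8 * Real.pi ^ 2 * ν * (t - s))) =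
            Real.exp (-(4 * Real.pi ^ 2 * ν * (t - s))) ^ 2 := by
          rw [← Real.exp_nat_mul]; congr 1; push_cast; ring
        rw [hexp, show 2 * (Torus.kineticEnergy (v s) * Real.exp (-(4 * Real.pi ^ 2 * ν * (t - s))) ^ 2) =
            (2 * Torus.kineticEnergy (v s)) * Real.exp (-(4 * Real.pi ^ 2 * ν * (t - s))) ^ 2 by ring,
          Real.sqrt_mul (by linarith), Real.sqrt_sq (Real.exp_pos _).le]

end GlimmPetrillo2026

end Summit.NavierStokesRegularity.NavierStokesRegularity.Theorems

end
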